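import Summits.QuantumFields.BalabanUV.T4Continuum.Support.RegionStarLineGaugeTower
import Summits.QuantumFields.BalabanUV.T4Continuum.Support.RegionInteriorW2

/-!
# `BalabanUV.T4Continuum.Support.RegionStarLineGaugeRod` — NE2 (node U1a) formalisation swarm, SUPPLIER item «Δ1-COERC-ORTH-LINE» under the
# owner's sub-row `T4-U1a.S-NE2-D1-DIRICHLET°` (vector layer): ON AN `e`-THIN PRODUCT REGION (thickness-one slabs, rods, staggered products)
# THE DEFECT-FREE STAR TOWER OF THE FAITHFUL `Δ_a(Ω₀)` CONVERGES AT THE TORUS RATE `L⁻¹` MODULO THE INJECTED LAW W3̃ ONLY — W1 supplied by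
# gen 9's line gauge (`sliceCoercive_of_isEThin'`), the interior gradient-form bound by leaf-07-g7's `interiorW2_of_slice` on product regions
# (unit b2b-balaban-t4-ne2-formalise-leaf-09, gen 9, v1)

HONEST FRAMING (T4-DAG p. 1).  [folklore] `U = 1`, ONE region that is both a product set (`IsCoordBox`) and `e`-thin (`IsEThin e S`), one
averaging scale, finite torus; JUNCTION bookkeeping of two landed ENDs — what stays displayed is the injected two-level law `hinj` (W3̃) alone;
general unions OPEN (and the level-uniform W1 binder is REFUTED on unions with a codimension-2 contact of exterior blocks, FINDING
F-ne2leaf09g9-1 ∕ `RegionGaugeCheckerboardNoGo`); nothing printed is a hypothesis; NE2 (U1a) NOT proved; spine PROVED 0/9 unchanged; NOT [B9]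
(3.23)–(3.27) as printed; NOT infinite volume, NOT the mass gap, NOT Clay.  HONEST DEPENDENCY (verbatim): «continuum YM on T⁴ ⇐ BetaPertH ∧
nine spine estimates (0/9 proved); BetaPertH ⇐ (D1) ∧ (D4) ∧ CAP+tail; G-an2-4 gates asym, D1 and NE2/3/4.»

WHAT THIS FILE PROVES (0 sorry):
 * **`towerLimitRate_star_renorm_thinBox`** = leaf-07-g7's `RegionInteriorW2.towerLimitRate_star_renorm_box_of_slice` with `hc`∕`hS` SUPPLIED
   (`c = thinConst d a a′`) on every `e`-thin coordinate-box region: `TowerLimitRate (AnR …) (L^d) (k ↦ (Δ_a(Ω₀)_k)⁻¹) (Cpert 0 √(CgIbox∕2·γ⋆⁻¹) C₁ 0 0 0) L⁻¹`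
   from `hinj` ALONE (`2 ≤ L`, `0 < a`, `0 < a′`).
 * non-vacuity: **`isCoordBox_slab`** — the thickness-one `e`-slab `{y : y_e = c}` is a coordinate box (and `e`-thin by
   `RegionStarLineGaugeEnd.isEThin_slab`); **`towerLimitRate_star_renorm_slab`**: on the slab (the region of the owner's zero-extension W2 no-go
   p228269) the renormalised star tower converges at the torus rate modulo W3̃ only.

ABSOLUTE RULE (cell, verbatim): «No internally-minted statement may enter as a cited fact. Every hypothesis is either kernel-proved in
this package or a verbatim quotation of a PUBLISHED theorem with page reference. The manuscript(s) under audit are NOT citable for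
their own disputed steps — they are the thing under adjudication; programme-internal (2001/route/tribunal) claims are never citable.»
[folklore] throughout; no def, no `def … : Prop`.  NOT CLAIMED: W3̃; anything beyond e-thin product regions; NE2; NE3.
-/

noncomputable section

open scoped BigOperators ComplexConjugate Matrix Matrix.Norms.L2Operator
open Finset

namespace Summit.QuantumFields.BalabanUV.T4Continuum.RegionStarLineGaugeRod

open Literature.MathematicalPhysics.QuantumFieldTheory.Balaban1983to89.B5Prop11Plancherel (Tor fine unitVec)
open Literature.MathematicalPhysics.QuantumFieldTheory.Balaban1983to89.B5G183RateUnitTower (lev)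
open Summit.QuantumFields.BalabanUV.T4Continuum
open Summit.QuantumFields.BalabanUV.T4Continuum.CovariantAveragingTower (TowerLimitRate)
open Summit.QuantumFields.BalabanUV.T4Continuum.BackgroundResolventTower
open Summit.QuantumFields.BalabanUV.T4Continuum.RegionGaugeFixedVector (regionDeltaA)
open Summit.QuantumFields.BalabanUV.T4Continuum.RegionStarLineGaugeRegion (IsEThin)
open Summit.QuantumFields.BalabanUV.T4Continuum.RegionStarLineGaugeEnd (isEThin_slab)
open Summit.QuantumFields.BalabanUV.T4Continuum.RegionStarLineGaugeTower (thinConst thinConst_pos sliceCoercive_of_isEThin')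
open Summit.QuantumFields.BalabanUV.T4Continuum.DirichletSubregionRenormTower (JnR AnR)
open Summit.QuantumFields.BalabanUV.T4Continuum.DirichletStarVectorTower (starP gamStar)
open Summit.QuantumFields.BalabanUV.T4Continuum.RegionInteriorW2 (CgIbox towerLimitRate_star_renorm_box_of_slice)
open Summit.QuantumFields.BalabanUV.Beta.GAN24.DirichletBoxTwoLevel (IsCoordBox)

variable {d : ℕ} (L : ℕ) [NeZero L] (M : Fin d → ℕ) [hM : ∀ μ, NeZero (M μ)] (S : Tor M → Prop) [DecidablePred S] (a a' : ℝ) (e : Fin d)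

/-- **THE STAR TOWER ON AN `e`-THIN PRODUCT REGION: TORUS RATE MODULO W3̃ ONLY** — leaf-07-g7's `towerLimitRate_star_renorm_box_of_slice` with
the W1 binder supplied by the line gauge at every level (`c = thinConst d a a′`). [folklore] -/
theorem towerLimitRate_star_renorm_thinBox (h : IsEThin M e S) (hbox : IsCoordBox M S) (hL : 2 ≤ L) (ha : 0 < a) (ha' : 0 < a') {C₁ : ℝ}
    (hinj : ∀ k, ‖(regionDeltaA (lev L (k + 1)) M a a' S)⁻¹ * JnR L M (starP L M S) k
        - JnR L M (starP L M S) k * (regionDeltaA (lev L k) M a a' S)⁻¹‖ ≤ C₁ * ((L : ℝ)⁻¹) ^ k) :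
    TowerLimitRate (AnR L M (starP L M S)) ((L : ℝ) ^ d) (fun k => (regionDeltaA (lev L k) M a a' S)⁻¹)
      (Cpert 0 (Real.sqrt (CgIbox d a' (thinConst d a a') / 2 * (gamStar d a' (thinConst d a a'))⁻¹)) C₁ 0 0 0) ((L : ℝ)⁻¹) :=
  towerLimitRate_star_renorm_box_of_slice L M S a a' hL hbox ha.le ha' (thinConst_pos a a' ha ha')
    (fun k => sliceCoercive_of_isEThin' M a a' (lev L k) e h ha ha') hinj

omit [NeZero L] [DecidablePred S] in
/-- **THE THICKNESS-ONE SLAB IS A COORDINATE BOX**: `{y : y_e = c}` is the product of `{c}` in direction `e` with the full circles elsewhere. [folklore] -/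
theorem isCoordBox_slab (c : ZMod (M e)) : IsCoordBox M (fun y : Tor M => y e = c) := by
  classical
  refine ⟨fun μ => if h : μ = e then (h ▸ ({c} : Finset (ZMod (M e)))) else Finset.univ, fun b => ?_⟩
  constructor
  · intro hb μ
    by_cases hμ : μ = e
    · subst hμ; simp [hb]
    · simp [hμ]
  · intro hb
    have := hb e
    simpa using this

/-- **ON THE THICKNESS-ONE SLAB THE RENORMALISED STAR TOWER CONVERGES AT THE TORUS RATE MODULO W3̃ ONLY** (`2 ≤ M e`, `2 ≤ L`, `0 < a`, `0 < a′`)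
— the region on which the zero-extension W2 binder is refuted (owner p228269) needs, for the renormalised pairing, nothing but the injected law.
[folklore] -/
theorem towerLimitRate_star_renorm_slab (hMe : 2 ≤ M e) (c : ZMod (M e)) (hL : 2 ≤ L) (ha : 0 < a) (ha' : 0 < a') {C₁ : ℝ}
    (hinj : ∀ k, ‖(regionDeltaA (lev L (k + 1)) M a a' (fun y : Tor M => y e = c))⁻¹ * JnR L M (starP L M (fun y : Tor M => y e = c)) k
        - JnR L M (starP L M (fun y : Tor M => y e = c)) k * (regionDeltaA (lev L k) M a a' (fun y : Tor M => y e = c))⁻¹‖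
          ≤ C₁ * ((L : ℝ)⁻¹) ^ k) :
    TowerLimitRate (AnR L M (starP L M (fun y : Tor M => y e = c))) ((L : ℝ) ^ d)
      (fun k => (regionDeltaA (lev L k) M a a' (fun y : Tor M => y e = c))⁻¹)
      (Cpert 0 (Real.sqrt (CgIbox d a' (thinConst d a a') / 2 * (gamStar d a' (thinConst d a a'))⁻¹)) C₁ 0 0 0) ((L : ℝ)⁻¹) :=
  towerLimitRate_star_renorm_thinBox L M (fun y : Tor M => y e = c) a a' e (isEThin_slab M e hMe c) (isCoordBox_slab M e c) hL ha ha' hinj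

end Summit.QuantumFields.BalabanUV.T4Continuum.RegionStarLineGaugeRod

end
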